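import Literature.Barriers.ValiantsHypothesis.AlgebraicNaturalProofsKRST
import Literature.Computability.AlgebraicComplexity.KRSTSuccinctnessBounds
import HarnessLib

/-!
# Algebraically natural proofs: the `VNP` side — Kumar–Ramya–Saptharishi–Tengse 2022, Main Theorem
# ("if VNP is hard, then so are equations for it"), PROVED (unconditionally)

Sequel of `AlgebraicNaturalProofsKRST.lean` (KRST's parameters; the class-generic conclusion
`isSuccinctHittingSet_of_permanentExpHard`). Here the succinctness clause is DISCHARGED for the
`VNP` slice, which makes KRST's Main Theorem a kernel theorem with NO named-fact hypothesis
(Kaltofen's factor theorem, used in print, is replaced by the proved root closure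
`RootLifting.lean`; the hardness of the permanent is of course the theorem's hypothesis):

* `SmallDefinable F n b` — the fixed-`n` `VNP`-succinct class ("`VNP(n, d=n)`", KRST Def. 3; the
  cell planners' `SmallDefinable` verbatim, `F` for `ℂ`): degree-`≤ n` Boolean sums
  `Σ_{e ∈ {0,1}^u} g(x, e)` with `u, L(g), deg g ≤ n^b`.
* `krstSuccinctIn_smallDefinable` — **KRST §3.4 PROVED**: for every `c` there are `b = 15(6c+3)`,
  `n₀ = 3` with `KRSTSuccinctIn F (SmallDefinable F · b) c n` for all `n ≥ n₀`: every
  `Σ_{|μ|≤n} Perm_[p](y|_{S_μ}) x^μ` (Reed–Solomon blocks, `p = krstPrime c n`, padded permanent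
  `per_{n^{3c}}`) is a Boolean sum of ONE circuit of size and degree `≤ n^b` over `≤ n^b` Boolean
  variables (`KRSTSucc.exists_boolSum_eq_target` + the §3.5 bounds `witnessBound_le_pow`,
  `params_le_pow`).
* `succinctHittingSetsFromVNP_of_permanentExpHard` — **KRST's Main Theorem**:
  `PermanentExpHardWith F c m₀ → ∃ b, ∀ a, ∃ n₀, ∀ n ≥ n₀,
  IsSuccinctHittingSet (degLEMonomials n) (SmallDefinable F n b) (Distinguishers F n a)` (ONE `b`
  for every level `a`, as in print: "`L(P) = N^{ω(1)}`"), and the natural-proofs form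
  `not_exists_isNaturalProof_smallDefinable_of_permanentExpHard`.

WHAT THIS IS NOT: says nothing about `VP`-succinctness (the unproven hypothesis input of the `VP`
statement, Summit-side `…Theorems/BarrierLeverSuccinctHittingSetsForVPKRSTDoor.lean`); the a.e./i.o. variant note below applies.

## References

* [KumarRamyaSaptharishiTengse2022] M. Kumar, C. Ramya, R. Saptharishi, A. Tengse, *If VNP is
  hard, then so are equations for it*, STACS 2022, Def. 3, Thm. MainThm, §3.4–3.5.
-/

noncomputable section

namespace Literature.Barriers.ValiantsHypothesis

open Literature.Computability.AlgebraicComplexity Literature.Computability.MetaComplexity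
  MvPolynomial


section VNPSide

variable (F : Type*) [Field F]

/-- **The `VNP`-succinct class at level `n`** ("`VNP(n, d = n)`" of KRST Def. 3, one exponent `b`
at a time; identical to the cell planners' `SmallDefinable` at `F = ℂ`): degree-`≤ n` polynomials
that are Valiant Boolean sums `f = Σ_{e ∈ {0,1}^u} g(x, e)` of a polynomial `g` in `n + u` variables
with `u, L(g), deg g ≤ n^b`. [cite: KumarRamyaSaptharishiTengse2022, Def. 3] -/
def SmallDefinable (n b : ℕ) : Set (MvPolynomial (Fin n) F) :=
  {f | f.totalDegree ≤ n ∧ ∃ u : ℕ, u ≤ n ^ b ∧ ∃ g : MvPolynomial (Fin n ⊕ Fin u) F,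
      complexity g ≤ n ^ b ∧ g.totalDegree ≤ n ^ b ∧ f = boolSum g}

variable {F}

/-- Arithmetic: the bounds of `KRSTSucc.witnessBound` / `witnessDegBound` / `nK + M` below the
fifteenth power of any common bound `T ≥ 2` of `n, K, 2^K, p, M`. [cite: KumarRamyaSaptharishiTengse2022, §3.5] -/
theorem witnessBound_le_pow {n K p M T : ℕ} (hn : n ≤ T) (hK : K ≤ T) (h2K : 2 ^ K ≤ T)
    (hp : p ≤ T) (hM : M ≤ T) (hT : 2 ≤ T) :
    KRSTSucc.witnessBound n K p M ≤ T ^ 15 ∧ KRSTSucc.witnessDegBound n K p M ≤ T ^ 15 ∧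
      n * K + M ≤ T ^ 15 := by
  have h1 : 1 ≤ T := by omega
  have hp2 : T ^ 2 ≤ T ^ 9 := Nat.pow_le_pow_right h1 (by norm_num)
  have hp3 : T ^ 3 ≤ T ^ 9 := Nat.pow_le_pow_right h1 (by norm_num)
  have hp4 : T ^ 4 ≤ T ^ 9 := Nat.pow_le_pow_right h1 (by norm_num)
  have hp5 : T ^ 5 ≤ T ^ 9 := Nat.pow_le_pow_right h1 (by norm_num)
  have hp6 : T ^ 6 ≤ T ^ 9 := Nat.pow_le_pow_right h1 (by norm_num)
  have hp1 : T ≤ T ^ 9 := by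
    calc T = T ^ 1 := (pow_one T).symm
      _ ≤ T ^ 9 := Nat.pow_le_pow_right h1 (by norm_num)
  have hp0 : 1 ≤ T ^ 9 := Nat.one_le_pow _ _ h1
  have h64 : 64 ≤ T ^ 6 := by
    calc (64 : ℕ) = 2 ^ 6 := by norm_num
      _ ≤ T ^ 6 := Nat.pow_le_pow_left hT 6
  have h15 : T ^ 15 = T ^ 6 * T ^ 9 := by rw [← pow_add]
  refine ⟨?_, ?_, ?_⟩
  · calc KRSTSucc.witnessBound n K p M
        ≤ ((T * T + 1) * (2 * (T * T) + 2) + 2 * (T * T)) + (T * T * T + 5 * (T * T)) + 1 +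
            ((3 * T + (T * (2 * T) + T) + 1) +
              (T * T * (T * ((T * T * T + 1) * (2 * (T * T * T) + 2) + 2 * (T * T) + 1) + T))) + 1 := by
          unfold KRSTSucc.witnessBound; gcongr
      _ = 2 * T ^ 9 + 4 * T ^ 6 + 2 * T ^ 5 + 2 * T ^ 4 + 5 * T ^ 3 + 13 * T ^ 2 + 4 * T + 5 := by
          ring
      _ ≤ 37 * T ^ 9 := by omega
      _ ≤ T ^ 6 * T ^ 9 := Nat.mul_le_mul_right _ (by omega)
      _ = T ^ 15 := h15.symm
  · calc KRSTSucc.witnessDegBound n K p M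
        ≤ T * T + T * T * (1 + T) + 3 * T * (T * T * T + 1) := by
          unfold KRSTSucc.witnessDegBound; gcongr
      _ = 3 * T ^ 4 + T ^ 3 + 2 * T ^ 2 + 3 * T := by ring
      _ ≤ 9 * T ^ 9 := by omega
      _ ≤ T ^ 6 * T ^ 9 := Nat.mul_le_mul_right _ (by omega)
      _ = T ^ 15 := h15.symm
  · calc n * K + M ≤ T * T + T := by gcongr
      _ = T ^ 2 + T := by ring
      _ ≤ 2 * T ^ 9 := by omega
      _ ≤ T ^ 6 * T ^ 9 := Nat.mul_le_mul_right _ (by omega)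
      _ = T ^ 15 := h15.symm

/-- KRST's parameters are all below `T = n^{6c+3}` for `n ≥ 3` (`K = log₂ n + 1`, `2^K ≤ 2n`,
`p ≤ 2(M² + n + 1)` by Bertrand, `M = n^{3c}`). [cite: KumarRamyaSaptharishiTengse2022, §3.5] -/
theorem params_le_pow (c n : ℕ) (hn : 3 ≤ n) :
    n ≤ n ^ (6 * c + 3) ∧ Nat.log 2 n + 1 ≤ n ^ (6 * c + 3) ∧
      2 ^ (Nat.log 2 n + 1) ≤ n ^ (6 * c + 3) ∧ krstPrime c n ≤ n ^ (6 * c + 3) ∧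
      krstBlock c n ≤ n ^ (6 * c + 3) ∧ 2 ≤ n ^ (6 * c + 3) := by
  have hn0 : n ≠ 0 := by omega
  have h1 : 1 ≤ n := by omega
  have hT : n ≤ n ^ (6 * c + 3) := Nat.le_self_pow (by omega) n
  have hlog : Nat.log 2 n + 1 ≤ n := Nat.succ_le_of_lt (Nat.log_lt_self 2 hn0)
  have h2K : 2 ^ (Nat.log 2 n + 1) ≤ n ^ (6 * c + 3) := by
    calc 2 ^ (Nat.log 2 n + 1) = 2 ^ Nat.log 2 n * 2 := pow_succ _ _
      _ ≤ n * n := Nat.mul_le_mul (Nat.pow_log_le_self 2 hn0) (by omega)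
      _ = n ^ 2 := (sq n).symm
      _ ≤ n ^ (6 * c + 3) := Nat.pow_le_pow_right h1 (by omega)
  have hM : krstBlock c n ≤ n ^ (6 * c + 3) := Nat.pow_le_pow_right h1 (by omega)
  have hp : krstPrime c n ≤ n ^ (6 * c + 3) := by
    have hB := leastPrimeGe_le (krstBlock c n * krstBlock c n + n + 1) (by omega)
    unfold krstPrime
    refine hB.trans ?_
    have hM2 : krstBlock c n * krstBlock c n = n ^ (6 * c) := by
      unfold krstBlock; rw [← pow_add]; ring_nf
    rw [hM2]
    have e1 : n ^ (6 * c) ≤ n ^ (6 * c + 1) := Nat.pow_le_pow_right h1 (by omega)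
    have e2 : n ≤ n ^ (6 * c + 1) := by
      calc n = n ^ 1 := (pow_one n).symm
        _ ≤ n ^ (6 * c + 1) := Nat.pow_le_pow_right h1 (by omega)
    have e3 : 1 ≤ n ^ (6 * c + 1) := Nat.one_le_pow _ _ h1
    have e4 : 9 ≤ n ^ 2 := by nlinarith
    calc 2 * (n ^ (6 * c) + n + 1) ≤ 2 * (3 * n ^ (6 * c + 1)) := by omega
      _ ≤ n ^ 2 * n ^ (6 * c + 1) := by nlinarith
      _ = n ^ (6 * c + 3) := by rw [← pow_add]; ring_nf
  exact ⟨hT, hlog.trans hT, h2K, hp, hM, le_trans (by omega) hT⟩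

variable [CharZero F]

/-- **KRST §3.4 — the Kabanets–Impagliazzo generator on the permanent is `VNP`-succinct**: for
every `c`, with `b = 15(6c+3)`, for all `n ≥ 3` and every numeric seed `y : 𝔽_p × 𝔽_p → F`
(`p = krstPrime c n`), the polynomial `Σ_{|μ| ≤ n} Perm_[p](y|_{S_μ}) x^μ` lies in
`SmallDefinable F n b` — PROVED (`KRSTSucc.exists_boolSum_eq_target` with `K = log₂ n + 1` bits
per exponent). This is the succinctness arrow that the `VP` barrier lacks.
[cite: KumarRamyaSaptharishiTengse2022, §3.4] -/
theorem krstSuccinctIn_smallDefinable (c : ℕ) :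
    ∃ b n₀ : ℕ, ∀ n : ℕ, n₀ ≤ n → KRSTSuccinctIn F (fun n => SmallDefinable F n b) c n := by
  refine ⟨15 * (6 * c + 3), 3, fun n hn y => ?_⟩
  obtain ⟨hnT, hKT, h2KT, hpT, hMT, hT2⟩ := params_le_pow c n hn
  set K := Nat.log 2 n + 1 with hK
  have hnK : n < 2 ^ K := Nat.lt_pow_succ_log_self (by norm_num) n
  obtain ⟨H, hsum, hcx, hdeg⟩ := KRSTSucc.exists_boolSum_eq_target (F := F)
    (krstBlock_sq_le_krstPrime c n) y hnK
  obtain ⟨hb1, hb2, hb3⟩ := witnessBound_le_pow hnT hKT h2KT hpT hMT hT2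
  have hpow : (n ^ (6 * c + 3)) ^ 15 = n ^ (15 * (6 * c + 3)) := by rw [← pow_mul, mul_comm]
  refine ⟨KRSTSucc.target F (krstBlock_sq_le_krstPrime c n) y n, ⟨?_, ?_⟩, fun μ => ?_⟩
  · exact KRSTSucc.totalDegree_target_le _ y
  · refine ⟨Fintype.card (KRSTSucc.Blk n K (krstBlock c n)), ?_, H, ?_, ?_, hsum.symm⟩
    · rw [KRSTSucc.card_blk, ← hpow]; exact hb3
    · rw [← hpow]; exact hcx.trans hb1
    · rw [← hpow]; exact hdeg.trans hb2
  · exact KRSTSucc.coeff_target _ y μ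

/-- **Kumar–Ramya–Saptharishi–Tengse 2022, Main Theorem ("if VNP is hard, then so are equations for
it") — PROVED, no named-fact hypothesis.** Over a field of characteristic zero, under
exponential hardness of the permanent `PermanentExpHardWith F c m₀`: there is ONE exponent `b` such
that for every distinguisher level `a`, eventually in `n`, the coefficient vectors of the
`VNP`-succinct class `SmallDefinable F n b` hit every nonzero polynomial of size and degree `≤ N^a`
in the `N = binom(2n,n)` coefficient variables — `VNP(n, n)` has no efficiently constructible
equations (with FSV Thm. 4). VARIANT NOTE: this is the "almost-everywhere from almost-everywhere"
form — hypothesis `2^j ≤ L(per_{j^c})` for ALL `j ≥ m₀`, conclusion for ALL large `n` — obtained by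
KRST's METHOD; the printed statement is "infinitely often from infinitely often" (KRST §3.5,
concluding note) and follows the same way along the hard subsequence. Ingredients: KI Lemma 30 / KRST Lemma 8 (`KabanetsImpagliazzo*.lean`,
with the root closure `RootLifting.lean` in place of Kaltofen's theorem), Reed–Solomon designs
(`KRSTDesign.lean`), the `VNP`-succinctness of §3.4 (`KRSTSuccinctness.lean`), the bookkeeping of
§3.5 (`AlgebraicNaturalProofsKRST.lean` and this file). [cite: KumarRamyaSaptharishiTengse2022, Thm. MainThm] -/
theorem succinctHittingSetsFromVNP_of_permanentExpHard {c m₀ : ℕ}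
    (hper : PermanentExpHardWith F c m₀) :
    ∃ b : ℕ, ∀ a : ℕ, ∃ n₀ : ℕ, ∀ n : ℕ, n₀ ≤ n →
      IsSuccinctHittingSet (degLEMonomials n) (SmallDefinable F n b) (Distinguishers F n a) := by
  obtain ⟨b, n₀, hb⟩ := krstSuccinctIn_smallDefinable (F := F) c
  exact ⟨b, fun a => isSuccinctHittingSet_of_permanentExpHard hper ⟨n₀, hb⟩ a⟩

/-- Hence (FSV Thm. 4) no level-`a` natural proof against the `VNP`-succinct class exists under
this hypothesis: "any nonzero polynomial that vanishes on the coefficient vectors of all polynomials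
in VNP requires super-polynomial size". [cite: KumarRamyaSaptharishiTengse2022, Thm. MainThm] -/
theorem not_exists_isNaturalProof_smallDefinable_of_permanentExpHard {c m₀ : ℕ}
    (hper : PermanentExpHardWith F c m₀) :
    ∃ b : ℕ, ∀ a : ℕ, ∃ n₀ : ℕ, ∀ n : ℕ, n₀ ≤ n →
      ¬ ∃ D, IsNaturalProof (degLEMonomials n) (SmallDefinable F n b) (Distinguishers F n a) D := by
  obtain ⟨b, hb⟩ := succinctHittingSetsFromVNP_of_permanentExpHard hper
  refine ⟨b, fun a => ?_⟩
  obtain ⟨n₀, hn₀⟩ := hb a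
  refine ⟨n₀, fun n hn => ?_⟩
  rw [exists_isNaturalProof_iff, not_not]
  exact hn₀ n hn

end VNPSide

end Literature.Barriers.ValiantsHypothesis

end
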